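import Summits.QuantumFields.BalabanUV.Beta.EriceFlowEnclosureB12AsPrintedHistoryContagionShiftFlowPicardLimit

/-!
# Beta / EriceFlowEnclosureB12AsPrintedHistoryContagionShiftFlowPicardPin — ASYMPTOTIC FREEDOM IS CONTAGIOUS, part 14: THE CONTINUUM TWO-PIN KERNEL.  For node U2's
# flow with memory `MemFlow B e h` (`T4BetaFlowWellPosed`) under a memory profile `MemoryProfile C_m θ γ B` (θ < 1) with ONE asymptotically free reference solution,
# parts 12–13 constructed THE box solution `solution B e` near zero pin by node U2's lattice-free Picard iteration.  Here the two solutions with pins `e ≤ e′` are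
# compared DIRECTLY, at every physical scale, in the chart 1∕h²: **`(2∕3)(1∕e² − 1∕e′²) ≤ 1∕h(m)² − 1∕h′(m)² ≤ (4∕3)(1∕e² − 1∕e′²)`** — strictly increasing, Lipschitz
# (`|h(m) − h′(m)| ≤ (64∕3)(e′ − e)`) and co-Lipschitz in the pin, UNIFORMLY IN THE SCALE, under `C_m(8e′³ + 16e′∕β*) ≤ (1 − θ)∕4` — part 9's same-depth lattice
# kernel `sep_sub_sep_le ∕ sep_twoSided_of_reference` WITHOUT lattice families and part 11's `memFlow_biLipschitz_of_typedTheorem2` WITHOUT `eq_gstar`: a SUP-NORM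
# induction along the two Picard iterations started from the profiled histories `(1∕e² + (β*∕4)q)^{−1∕2}`, `(1∕e′² + (β*∕4)q)^{−1∕2}` (chart difference ≡ Δ₀), whose AF
# weights `u²u′ ≤ (1∕(4e′²) + (β*∕4)q)^{−3∕2}` sum to `≤ 8e′³ + 16e′∕β*` (node U2's `sum_profWeights_le`), then the scale-wise limit of part 13.  Abstract in B; part 15
# reads it on the as-printed carrier (β-flow team, prover 1, unit `b2b-balaban-beta-bflow-p1`, gen 37; ROW AP-I·Uc × NODE U2)

HONEST FRAMING (page 1 of everything the β sub-cell writes): discharging `BetaPertH` makes Bałaban's UV stability UNCONDITIONAL — a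
real constructive-QFT result; it is NOT the continuum limit and NOT the Clay problem.  HONEST DEPENDENCY (cell reorg 2026-08-19,
verbatim): «continuum YM on T⁴ ⇐ BetaPertH ∧ nine spine estimates (0/9 proved); BetaPertH ⇐ (D1) ∧ (D4) ∧ CAP+tail; G-an2-4 gates
asym, D1 and NE2/3/4.»  THIS MODULE DISCHARGES NOTHING: [folklore] real analysis (finite sums, geometric `tsum` tails, an induction along two iterations, limits) over
node U2's HYPOTHESIS SHAPES `T4BetaStationary.{SeqBox, MemoryProfile}`, `T4BetaFlowWellPosed.{MemFlow, drive, picard, solution}` and `T4CouplingMatching.{prof, sprof,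
sum_profWeights_le}` on an ABSTRACT functional `B : (ℕ → ℝ) → ℝ` — the shapes node U2 derives (`memoryProfile_betaInf`, `memFlow_gstar`) from its NE4 ∕ history-moduli
LETTERS (NOT PRINTED for [I] = T. Bałaban, Commun. Math. Phys. **109** (1987) [Balaban1987RG1]: GAPS G-t4-U2-1 ∕ -2; p. 298 says only that β_j depends on the preceding
couplings); the reference profile is the shape of (0.31)'s lower half (Theorem 2 p. 259, STATED WITHOUT PROOF) in the continuum.  Nothing of Bałaban's β is asserted;
nothing of node U2's modules is restated or modified.

THE POINT.  A sup-norm comparison of two box solutions h, h′ with different pins needs an a-priori BOUNDED chart separation, which two solutions do not offer (their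
separation is only known to grow at most linearly).  The Picard iterations of parts 12–13 supply it: started from the PROFILED histories `u₀ = 1∕sprof e (β*∕4)`,
`u₀′ = 1∕sprof e′ (β*∕4)` the chart separation is EXACTLY Δ₀ = 1∕e² − 1∕e′² at step 0, and `|Δ^{(n+1)}_m − Δ₀| = |drive B u_n m − drive B u′_n m| ≤ (C_m∕(1−θ))·(8e′³ +
16e′∕β*)·sup_q |Δ^{(n)}_q|` (§17: `|u − u′| ≤ u²u′|Δ|`, both iterates carrying the quarter profile from 2e′, the fading row `Σ_j θ^j ≤ 1∕(1−θ)` against the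
ANTITONE weight, node U2's telescoped profile sum) keeps `|Δ^{(n)} − Δ₀| ≤ Δ₀∕3` for all n under `C_m(8e′³ + 16e′∕β*) ≤ (1−θ)∕4`; part 13's scale-wise convergence to
`solution B e`, `solution B e′` and part 10's uniqueness transfer the law to ANY two box solutions.

WHAT THIS FILE PROVES (0 sorry, 0 def): §17 **`abs_drive_sub_drive_le_sup`** (the sup-norm kernel), `profStart_mem`, **`twoPin_picardIter_sep_le`** (the induction),
§18 `tendsto_invSq_picardIter`, **`sep_twoSided_solution`**, **`sep_twoSided_of_reference_flow`** (ANY box solutions with pins e ≤ e′ below the threshold), **`lt_of_pin_lt`**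
(strictly increasing in the pin at every scale), **`abs_sub_le_of_pins`** (`|h(m) − h′(m)| ≤ (64∕3)(e′ − e)`: Lipschitz in the pin uniformly in the scale).
NOT CLAIMED: anything about Bałaban's β; sharp constants; `BetaPertH`; the continuum limit of the measures; Clay.
-/

namespace Summit.QuantumFields.BalabanUV.Beta.EriceFlowEnclosureB12AsPrintedHistoryContagionShiftFlowPicardPin

open Finset Filter Topology
open Literature.MathematicalPhysics.QuantumFieldTheory.Balaban1983to89
open Literature.MathematicalPhysics.QuantumFieldTheory.Balaban1983to89.T4CouplingMatching (prof sprof sprof_pos sprof_sq prof_pos sprof_zero sum_profWeights_le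
  abs_sub_le_of_inv_sq)
open Literature.MathematicalPhysics.QuantumFieldTheory.Balaban1983to89.T4BetaStationary (SeqBox MemoryProfile summable_profile abs_sub_le_of_seqBox
  tsum_profile_le)
open Literature.MathematicalPhysics.QuantumFieldTheory.Balaban1983to89.T4BetaFlowWellPosed (MemFlow drive picard solution seqBox_shift invSq_eq_of_memFlow
  one_div_sq_one_div_sqrt)
open Summit.QuantumFields.BalabanUV.Beta.EriceFlowEnclosureB12AsPrintedHistoryContagion (sprof_le_sprof)
open Summit.QuantumFields.BalabanUV.Beta.EriceFlowEnclosureB12AsPrintedHistoryContagionShiftFlow (le_invSprof_of_prof_le le_two_mul_pin_of_reference_flow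
  memFlow_unique_of_reference)
open Summit.QuantumFields.BalabanUV.Beta.EriceFlowEnclosureB12AsPrintedHistoryContagionShiftFlowPicard (picardIter_mem picardIter_profile invSq_picardIter_succ)
open Summit.QuantumFields.BalabanUV.Beta.EriceFlowEnclosureB12AsPrintedHistoryContagionShiftFlowPicardLimit (memFlow_solution_of_reference
  eq_solution_of_memFlow_of_reference tendsto_picardIter_solution)

noncomputable section

/-! ## §17 The sup-norm kernel over the quarter profiles, and the induction along two Picard iterations -/

/-- **THE SUP-NORM KERNEL.**  `B` with memory profile `(C_m, θ)` on ]0, γ]^ℕ (0 ≤ θ < 1, C_m ≥ 0); two box histories u, u′ BOTH carrying the quarter profile from 2f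
(`1∕(4f²) + (β*∕4)q ≤ 1∕u(q)², 1∕u′(q)²`, f > 0, β* > 0) whose chart separation is uniformly bounded, `|1∕u(q)² − 1∕u′(q)²| ≤ M` for all q.  THEN at every scale m
`|drive B u m − drive B u′ m| ≤ (C_m∕(1 − θ))·(8f³ + 16f∕β*)·M`: `|u − u′| ≤ u²u′|Δ| ≤ w_q M` with the ANTITONE AF weight `w_q = (1∕(4f²) + (β*∕4)q)^{−3∕2}`, the fading
row `Σ_j θ^j w_{p+1+j} ≤ w_{p+1}∕(1 − θ)`, and node U2's telescoped profile sum `Σ_{q≤m} w_q ≤ 8f³ + 16f∕β*` (`sum_profWeights_le` at base 2f, rate β*∕4) — UNIFORM IN m.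
[cite: Balaban1987RG1, Thm 2 (0.31) p.259 with (0.20) p.256 and p.298] -/
theorem abs_drive_sub_drive_le_sup {B : (ℕ → ℝ) → ℝ} {Cm θ γ bs f M : ℝ} {u u' : ℕ → ℝ}
    (hB : MemoryProfile Cm θ γ B) (hCm : 0 ≤ Cm) (hθ0 : 0 ≤ θ) (hθ1 : θ < 1) (hbs : 0 < bs) (hf : 0 < f)
    (hus : SeqBox γ u) (hus' : SeqBox γ u')
    (hPu : ∀ q : ℕ, 1 / (4 * f ^ 2) + bs / 4 * (q : ℝ) ≤ 1 / (u q) ^ 2)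
    (hPu' : ∀ q : ℕ, 1 / (4 * f ^ 2) + bs / 4 * (q : ℝ) ≤ 1 / (u' q) ^ 2)
    (hM : ∀ q : ℕ, |1 / (u q) ^ 2 - 1 / (u' q) ^ 2| ≤ M) (m : ℕ) :
    |drive B u m - drive B u' m| ≤ Cm / (1 - θ) * (8 * f ^ 3 + 16 * f / bs) * M := by
  have h1θ : 0 < 1 - θ := by linarith
  have h2f : 0 < 2 * f := by positivity
  have hb4 : 0 < bs / 4 := by positivity
  have hp0 := sprof_pos h2f hb4.le
  have hM0 : 0 ≤ M := (abs_nonneg _).trans (hM 0)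
  have e4 : (2 * f) ^ 2 = 4 * f ^ 2 := by ring
  set w : ℕ → ℝ := fun q => 1 / (sprof (2 * f) (bs / 4) q) ^ 2 * (1 / sprof (2 * f) (bs / 4) q) with hw
  have hw0 : ∀ q, 0 ≤ w q := fun q => by
    have hpq := hp0 q
    show 0 ≤ 1 / (sprof (2 * f) (bs / 4) q) ^ 2 * (1 / sprof (2 * f) (bs / 4) q)
    positivity
  have hwanti : ∀ {a b : ℕ}, a ≤ b → w b ≤ w a := by
    intro a b hab
    have hpa := hp0 a
    have h1 : 1 / sprof (2 * f) (bs / 4) b ≤ 1 / sprof (2 * f) (bs / 4) a :=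
      one_div_le_one_div_of_le (hp0 a) (sprof_le_sprof hb4.le hab)
    have h2 : 1 / (sprof (2 * f) (bs / 4) b) ^ 2 ≤ 1 / (sprof (2 * f) (bs / 4) a) ^ 2 :=
      one_div_le_one_div_of_le (pow_pos (hp0 a) 2) (pow_le_pow_left₀ (hp0 a).le (sprof_le_sprof hb4.le hab) 2)
    show 1 / (sprof (2 * f) (bs / 4) b) ^ 2 * (1 / sprof (2 * f) (bs / 4) b) ≤ 1 / (sprof (2 * f) (bs / 4) a) ^ 2 * (1 / sprof (2 * f) (bs / 4) a)
    exact mul_le_mul h2 h1 (one_div_pos.mpr (hp0 b)).le (by positivity)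
  -- pointwise: |u q − u′ q| ≤ w_q · M
  have hpt : ∀ q, |u q - u' q| ≤ w q * M := by
    intro q
    have hq := (hus q).1
    have hq' := (hus' q).1
    have hu1 : u q ≤ 1 / sprof (2 * f) (bs / 4) q := le_invSprof_of_prof_le h2f hb4.le hq (by rw [e4]; exact hPu q)
    have hu1' : u' q ≤ 1 / sprof (2 * f) (bs / 4) q := le_invSprof_of_prof_le h2f hb4.le hq' (by rw [e4]; exact hPu' q)
    have hpq := hp0 q
    have hsq : (u q) ^ 2 ≤ 1 / (sprof (2 * f) (bs / 4) q) ^ 2 :=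
      calc (u q) ^ 2 ≤ (1 / sprof (2 * f) (bs / 4) q) ^ 2 := pow_le_pow_left₀ hq.le hu1 2
        _ = 1 / (sprof (2 * f) (bs / 4) q) ^ 2 := by rw [one_div_pow]
    calc |u q - u' q| ≤ (u q) ^ 2 * u' q * |1 / (u q) ^ 2 - 1 / (u' q) ^ 2| := abs_sub_le_of_inv_sq hq hq'
      _ ≤ 1 / (sprof (2 * f) (bs / 4) q) ^ 2 * (1 / sprof (2 * f) (bs / 4) q) * M :=
          mul_le_mul (mul_le_mul hsq hu1' hq'.le (by positivity)) (hM q) (abs_nonneg _) (by positivity)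
      _ = w q * M := by rw [hw]
  -- one memory term
  have hterm : ∀ p : ℕ, |B (fun j => u (p + 1 + j)) - B (fun j => u' (p + 1 + j))| ≤ Cm * (w (p + 1) * M / (1 - θ)) := by
    intro p
    have hs := summable_profile hθ0 hθ1 (seqBox_shift hus (p + 1)) (seqBox_shift hus' (p + 1))
    have hg : Summable fun j : ℕ => (w (p + 1) * M) * θ ^ j := (summable_geometric_of_lt_one hθ0 hθ1).mul_left _
    refine (hB _ _ (seqBox_shift hus (p + 1)) (seqBox_shift hus' (p + 1))).trans (mul_le_mul_of_nonneg_left ?_ hCm)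
    calc ∑' j, θ ^ j * |u (p + 1 + j) - u' (p + 1 + j)| ≤ ∑' j : ℕ, (w (p + 1) * M) * θ ^ j := by
          refine hs.tsum_le_tsum (fun j => ?_) hg
          calc θ ^ j * |u (p + 1 + j) - u' (p + 1 + j)| ≤ θ ^ j * (w (p + 1 + j) * M) :=
                mul_le_mul_of_nonneg_left (hpt _) (pow_nonneg hθ0 j)
            _ ≤ θ ^ j * (w (p + 1) * M) :=
                mul_le_mul_of_nonneg_left (mul_le_mul_of_nonneg_right (hwanti (by omega)) hM0) (pow_nonneg hθ0 j)
            _ = (w (p + 1) * M) * θ ^ j := mul_comm _ _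
      _ = (w (p + 1) * M) * ∑' j : ℕ, θ ^ j := tsum_mul_left
      _ = w (p + 1) * M / (1 - θ) := by rw [tsum_geometric_of_lt_one hθ0 hθ1, div_eq_mul_inv]
  -- the weight sum
  have hW : ∑ p ∈ range m, w (p + 1) ≤ 8 * f ^ 3 + 16 * f / bs := by
    have h1 : ∑ p ∈ range m, w (p + 1) ≤ ∑ q ∈ range (m + 1), w q := by
      rw [Finset.sum_range_succ']; linarith [hw0 0]
    have h2 : ∑ q ∈ range (m + 1), w q = ∑ i ∈ range (m + 1), w (m - i) := by
      rw [← Finset.sum_range_reflect w (m + 1)]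
      exact Finset.sum_congr rfl fun i _ => congrArg w (by omega)
    have h3 : ∑ i ∈ range (m + 1), 1 / (sprof (2 * f) (bs / 4) (m - i)) ^ 2 * (1 / sprof (2 * f) (bs / 4) (m - i))
        ≤ (2 * f) ^ 3 + 2 * (2 * f) / (bs / 4) := sum_profWeights_le h2f hb4 m
    have h4 : (2 * f) ^ 3 + 2 * (2 * f) / (bs / 4) = 8 * f ^ 3 + 16 * f / bs := by
      field_simp
      ring
    calc ∑ p ∈ range m, w (p + 1) ≤ ∑ q ∈ range (m + 1), w q := h1
      _ = ∑ i ∈ range (m + 1), w (m - i) := h2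
      _ ≤ (2 * f) ^ 3 + 2 * (2 * f) / (bs / 4) := h3
      _ = 8 * f ^ 3 + 16 * f / bs := h4
  unfold T4BetaFlowWellPosed.drive
  rw [← Finset.sum_sub_distrib]
  calc |∑ p ∈ range m, (B (fun j => u (p + 1 + j)) - B (fun j => u' (p + 1 + j)))|
      ≤ ∑ p ∈ range m, |B (fun j => u (p + 1 + j)) - B (fun j => u' (p + 1 + j))| := Finset.abs_sum_le_sum_abs _ _
    _ ≤ ∑ p ∈ range m, Cm * (w (p + 1) * M / (1 - θ)) := Finset.sum_le_sum fun p _ => hterm p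
    _ = Cm / (1 - θ) * M * ∑ p ∈ range m, w (p + 1) := by
        rw [Finset.mul_sum]; refine Finset.sum_congr rfl fun p _ => ?_; field_simp
    _ ≤ Cm / (1 - θ) * M * (8 * f ^ 3 + 16 * f / bs) := mul_le_mul_of_nonneg_left hW (by positivity)
    _ = Cm / (1 - θ) * (8 * f ^ 3 + 16 * f / bs) * M := by ring

/-- THE PROFILED START `u₀(q) = 1∕sprof e (β*∕4) q = (1∕e² + (β*∕4)q)^{−1∕2}`: box-valued (2e ≤ γ), below 2e, pinned `u₀(0) = e`, chart `1∕u₀(q)² = 1∕e² + (β*∕4)q`.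
[folklore] -/
theorem profStart_mem {γ bs e : ℝ} (hbs : 0 < bs) (he : 0 < e) (h2e : 2 * e ≤ γ) :
    SeqBox γ (fun q => 1 / sprof e (bs / 4) q) ∧ (∀ q : ℕ, (fun q => 1 / sprof e (bs / 4) q) q ≤ 2 * e) ∧
      ∀ q : ℕ, 1 / ((fun q => 1 / sprof e (bs / 4) q) q) ^ 2 = 1 / e ^ 2 + bs / 4 * (q : ℝ) := by
  have hb4 : 0 ≤ bs / 4 := by positivity
  have hp0 := sprof_pos he hb4
  have hle : ∀ q : ℕ, 1 / sprof e (bs / 4) q ≤ e := fun q => by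
    calc 1 / sprof e (bs / 4) q ≤ 1 / sprof e (bs / 4) 0 := one_div_le_one_div_of_le (hp0 0) (sprof_le_sprof hb4 (Nat.zero_le q))
      _ = e := by rw [sprof_zero he, one_div_one_div]
  refine ⟨fun q => ⟨one_div_pos.mpr (hp0 q), (hle q).trans (by linarith)⟩, fun q => (hle q).trans (by linarith), fun q => ?_⟩
  show 1 / (1 / Real.sqrt (prof e (bs / 4) q)) ^ 2 = 1 / e ^ 2 + bs / 4 * (q : ℝ)
  rw [one_div_sq_one_div_sqrt (prof_pos he hb4 q)]
  rfl

/-- **THE INDUCTION ALONG THE TWO PICARD ITERATIONS.**  `B` with memory profile `(C_m, θ)`, ONE AF reference solution t (pin g*), pins `0 < e ≤ e′` with `2e′ ≤ γ`, e′ below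
the threshold of parts 10 ∕ 12 (`4C_m e′ ≤ β*(1 − θ)`, `e′²·(1∕g*² + C_mγ∕(1 − θ)² + (2C_m∕((1 − θ)β*))²) ≤ 3∕4`) AND `C_m(8e′³ + 16e′∕β*) ≤ (1 − θ)∕4`.  Along the iterations
`u_n = (picard B e)^[n] u₀`, `u′_n = (picard B e′)^[n] u₀′` from the profiled starts, with Δ₀ = 1∕e² − 1∕e′²: **`|(1∕u_n(q)² − 1∕u′_n(q)²) − Δ₀| ≤ Δ₀∕3`** for all n, q
(n = 0: the difference IS Δ₀; step: `invSq_picardIter_succ` + `abs_drive_sub_drive_le_sup` with M = 4Δ₀∕3, both iterates carrying the quarter profile from 2e′).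
[cite: Balaban1987RG1, Thm 2 (0.31) p.259 with (0.20) p.256 and p.298] -/
theorem twoPin_picardIter_sep_le {B : (ℕ → ℝ) → ℝ} {Cm θ γ bs ta gs e e' : ℝ} {t : ℕ → ℝ}
    (hB : MemoryProfile Cm θ γ B) (hCm : 0 ≤ Cm) (hθ0 : 0 ≤ θ) (hθ1 : θ < 1) (hbs : 0 < bs) (hta : 0 < ta)
    (hts : SeqBox γ t) (htf : MemFlow B gs t) (hprof : ∀ m : ℕ, 1 / ta ^ 2 + bs * (m : ℝ) ≤ 1 / (t m) ^ 2)
    (he : 0 < e) (hee' : e ≤ e') (h2e' : 2 * e' ≤ γ)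
    (hs1 : 4 * Cm * e' ≤ bs * (1 - θ))
    (hs2 : e' ^ 2 * (1 / gs ^ 2 + Cm * γ / (1 - θ) ^ 2 + (2 * Cm / ((1 - θ) * bs)) ^ 2) ≤ 3 / 4)
    (hs5 : Cm * (8 * e' ^ 3 + 16 * e' / bs) ≤ (1 - θ) / 4) :
    ∀ n q : ℕ, |(1 / ((picard B e)^[n] (fun q => 1 / sprof e (bs / 4) q) q) ^ 2
        - 1 / ((picard B e')^[n] (fun q => 1 / sprof e' (bs / 4) q) q) ^ 2) - (1 / e ^ 2 - 1 / e' ^ 2)|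
      ≤ (1 / e ^ 2 - 1 / e' ^ 2) / 3 := by
  have h1θ : 0 < 1 - θ := by linarith
  have he' : 0 < e' := he.trans_le hee'
  have h2e : 2 * e ≤ γ := by linarith
  have hQ0 : 0 ≤ 1 / gs ^ 2 + Cm * γ / (1 - θ) ^ 2 + (2 * Cm / ((1 - θ) * bs)) ^ 2 := by
    have hγ : 0 ≤ γ := by linarith
    positivity
  have hs1e : 4 * Cm * e ≤ bs * (1 - θ) := (by nlinarith : 4 * Cm * e ≤ 4 * Cm * e').trans hs1
  have hs2e : e ^ 2 * (1 / gs ^ 2 + Cm * γ / (1 - θ) ^ 2 + (2 * Cm / ((1 - θ) * bs)) ^ 2) ≤ 3 / 4 :=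
    (mul_le_mul_of_nonneg_right (pow_le_pow_left₀ he.le hee' 2) hQ0).trans hs2
  have hΔ0 : 0 ≤ 1 / e ^ 2 - 1 / e' ^ 2 := by
    rw [sub_nonneg]; exact one_div_le_one_div_of_le (by positivity) (pow_le_pow_left₀ he.le hee' 2)
  obtain ⟨hu0s, hu0env, hu0chart⟩ := profStart_mem (γ := γ) hbs he h2e
  obtain ⟨hu0s', hu0env', hu0chart'⟩ := profStart_mem (γ := γ) hbs he' h2e'
  have hmem := picardIter_mem hB hCm hθ0 hθ1 hbs hta hts htf hprof he h2e hu0s hu0env hs1e hs2e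
  have hmem' := picardIter_mem hB hCm hθ0 hθ1 hbs hta hts htf hprof he' h2e' hu0s' hu0env' hs1 hs2
  have hinv := invSq_picardIter_succ hB hCm hθ0 hθ1 hbs hta hts htf hprof he h2e hu0s hu0env hs1e hs2e
  have hinv' := invSq_picardIter_succ hB hCm hθ0 hθ1 hbs hta hts htf hprof he' h2e' hu0s' hu0env' hs1 hs2
  have hprofit := picardIter_profile hB hCm hθ0 hθ1 hbs hta hts htf hprof he h2e hu0s hu0env hs1e hs2e
  have hprofit' := picardIter_profile hB hCm hθ0 hθ1 hbs hta hts htf hprof he' h2e' hu0s' hu0env' hs1 hs2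
  -- both iterations carry the quarter profile from 2e′ at every step
  have h44 : 1 / (4 * e' ^ 2) ≤ 1 / (4 * e ^ 2) :=
    one_div_le_one_div_of_le (by positivity) (by nlinarith [mul_le_mul hee' hee' he.le he'.le])
  have h41 : 1 / (4 * e' ^ 2) ≤ 1 / e ^ 2 := h44.trans (one_div_le_one_div_of_le (by positivity) (by nlinarith))
  have h41' : 1 / (4 * e' ^ 2) ≤ 1 / e' ^ 2 := one_div_le_one_div_of_le (by positivity) (by nlinarith)
  have hP : ∀ n q : ℕ, 1 / (4 * e' ^ 2) + bs / 4 * (q : ℝ) ≤ 1 / ((picard B e)^[n] (fun q => 1 / sprof e (bs / 4) q) q) ^ 2 := by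
    intro n q
    rcases n with _ | n
    · rw [Function.iterate_zero, id, hu0chart q]; linarith
    · exact (add_le_add h44 le_rfl).trans (hprofit n q)
  have hP' : ∀ n q : ℕ, 1 / (4 * e' ^ 2) + bs / 4 * (q : ℝ) ≤ 1 / ((picard B e')^[n] (fun q => 1 / sprof e' (bs / 4) q) q) ^ 2 := by
    intro n q
    rcases n with _ | n
    · rw [Function.iterate_zero, id, hu0chart' q]; linarith
    · exact hprofit' n q
  -- the contraction factor
  have hL : Cm / (1 - θ) * (8 * e' ^ 3 + 16 * e' / bs) ≤ 1 / 4 := by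
    rw [div_mul_eq_mul_div, div_le_iff₀ h1θ]; linarith
  intro n
  induction n with
  | zero =>
    intro q
    rw [Function.iterate_zero, id, Function.iterate_zero, id, hu0chart q, hu0chart' q]
    have : 1 / e ^ 2 + bs / 4 * (q : ℝ) - (1 / e' ^ 2 + bs / 4 * (q : ℝ)) - (1 / e ^ 2 - 1 / e' ^ 2) = 0 := by ring
    rw [this, abs_zero]; positivity
  | succ n ih =>
    intro q
    rw [hinv n q, hinv' n q]
    have e1 : 1 / e ^ 2 + drive B ((picard B e)^[n] (fun q => 1 / sprof e (bs / 4) q)) q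
        - (1 / e' ^ 2 + drive B ((picard B e')^[n] (fun q => 1 / sprof e' (bs / 4) q)) q) - (1 / e ^ 2 - 1 / e' ^ 2)
        = drive B ((picard B e)^[n] (fun q => 1 / sprof e (bs / 4) q)) q - drive B ((picard B e')^[n] (fun q => 1 / sprof e' (bs / 4) q)) q := by
      ring
    rw [e1]
    have hM : ∀ q' : ℕ, |1 / ((picard B e)^[n] (fun q => 1 / sprof e (bs / 4) q) q') ^ 2
        - 1 / ((picard B e')^[n] (fun q => 1 / sprof e' (bs / 4) q) q') ^ 2| ≤ (1 / e ^ 2 - 1 / e' ^ 2) + (1 / e ^ 2 - 1 / e' ^ 2) / 3 := by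
      intro q'
      have h := ih q'
      have := abs_sub_abs_le_abs_sub (1 / ((picard B e)^[n] (fun q => 1 / sprof e (bs / 4) q) q') ^ 2
        - 1 / ((picard B e')^[n] (fun q => 1 / sprof e' (bs / 4) q) q') ^ 2) (1 / e ^ 2 - 1 / e' ^ 2)
      rw [abs_of_nonneg hΔ0] at this
      linarith
    have hk := abs_drive_sub_drive_le_sup hB hCm hθ0 hθ1 hbs he' (hmem n).1 (hmem' n).1 (hP n) (hP' n) hM q
    calc _ ≤ Cm / (1 - θ) * (8 * e' ^ 3 + 16 * e' / bs) * ((1 / e ^ 2 - 1 / e' ^ 2) + (1 / e ^ 2 - 1 / e' ^ 2) / 3) := hk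
      _ ≤ 1 / 4 * ((1 / e ^ 2 - 1 / e' ^ 2) + (1 / e ^ 2 - 1 / e' ^ 2) / 3) := mul_le_mul_of_nonneg_right hL (by positivity)
      _ = (1 / e ^ 2 - 1 / e' ^ 2) / 3 := by ring

/-! ## §18 The two-pin law for the box solutions: strictly increasing, Lipschitz and co-Lipschitz in the pin, uniformly in the scale -/

/-- Along the iteration from any box start ≤ 2e the CHART VARIABLE converges too: `1∕((picard B e)^[n] u)(q)² → 1∕(solution B e q)²`. [folklore] -/
theorem tendsto_invSq_picardIter {B : (ℕ → ℝ) → ℝ} {Cm θ γ bs ta gs e : ℝ} {t u : ℕ → ℝ}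
    (hB : MemoryProfile Cm θ γ B) (hCm : 0 ≤ Cm) (hθ0 : 0 ≤ θ) (hθ1 : θ < 1) (hbs : 0 < bs) (hta : 0 < ta)
    (hts : SeqBox γ t) (htf : MemFlow B gs t) (hprof : ∀ m : ℕ, 1 / ta ^ 2 + bs * (m : ℝ) ≤ 1 / (t m) ^ 2)
    (he : 0 < e) (h2e : 2 * e ≤ γ) (hus : SeqBox γ u) (henv : ∀ q, u q ≤ 2 * e)
    (hs1 : 4 * Cm * e ≤ bs * (1 - θ))
    (hs2 : e ^ 2 * (1 / gs ^ 2 + Cm * γ / (1 - θ) ^ 2 + (2 * Cm / ((1 - θ) * bs)) ^ 2) ≤ 3 / 4)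
    (hs4 : 64 * Cm * e ^ 3 ≤ (1 - θ) ^ 2) (q : ℕ) :
    Tendsto (fun n => 1 / ((picard B e)^[n] u q) ^ 2) atTop (𝓝 (1 / (solution B e q) ^ 2)) := by
  have hpos : 0 < solution B e q := ((memFlow_solution_of_reference hB hCm hθ0 hθ1 hbs hta hts htf hprof he h2e hs1 hs2 hs4).1 q).1
  exact tendsto_const_nhds.div ((tendsto_picardIter_solution hB hCm hθ0 hθ1 hbs hta hts htf hprof he h2e hus henv hs1 hs2 hs4 q).pow 2)
    (pow_ne_zero 2 hpos.ne')

/-- **THE TWO-PIN LAW FOR node U2's `solution`.**  Under the hypotheses of `twoPin_picardIter_sep_le` plus `64C_m e′³ ≤ (1 − θ)²`: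
`|(1∕(solution B e m)² − 1∕(solution B e′ m)²) − (1∕e² − 1∕e′²)| ≤ (1∕e² − 1∕e′²)∕3` at every scale m (the scale-wise limit of the induction, part 13).
[cite: Balaban1987RG1, Thm 2 (0.31) p.259 with (0.20) p.256 and p.298] -/
theorem sep_twoSided_solution {B : (ℕ → ℝ) → ℝ} {Cm θ γ bs ta gs e e' : ℝ} {t : ℕ → ℝ}
    (hB : MemoryProfile Cm θ γ B) (hCm : 0 ≤ Cm) (hθ0 : 0 ≤ θ) (hθ1 : θ < 1) (hbs : 0 < bs) (hta : 0 < ta)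
    (hts : SeqBox γ t) (htf : MemFlow B gs t) (hprof : ∀ m : ℕ, 1 / ta ^ 2 + bs * (m : ℝ) ≤ 1 / (t m) ^ 2)
    (he : 0 < e) (hee' : e ≤ e') (h2e' : 2 * e' ≤ γ)
    (hs1 : 4 * Cm * e' ≤ bs * (1 - θ))
    (hs2 : e' ^ 2 * (1 / gs ^ 2 + Cm * γ / (1 - θ) ^ 2 + (2 * Cm / ((1 - θ) * bs)) ^ 2) ≤ 3 / 4)
    (hs4 : 64 * Cm * e' ^ 3 ≤ (1 - θ) ^ 2) (hs5 : Cm * (8 * e' ^ 3 + 16 * e' / bs) ≤ (1 - θ) / 4) (m : ℕ) :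
    |(1 / (solution B e m) ^ 2 - 1 / (solution B e' m) ^ 2) - (1 / e ^ 2 - 1 / e' ^ 2)| ≤ (1 / e ^ 2 - 1 / e' ^ 2) / 3 := by
  have h1θ : 0 < 1 - θ := by linarith
  have he' : 0 < e' := he.trans_le hee'
  have h2e : 2 * e ≤ γ := by linarith
  have hQ0 : 0 ≤ 1 / gs ^ 2 + Cm * γ / (1 - θ) ^ 2 + (2 * Cm / ((1 - θ) * bs)) ^ 2 := by
    have hγ : 0 ≤ γ := by linarith
    positivity
  have hs1e : 4 * Cm * e ≤ bs * (1 - θ) := (by nlinarith : 4 * Cm * e ≤ 4 * Cm * e').trans hs1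
  have hs2e : e ^ 2 * (1 / gs ^ 2 + Cm * γ / (1 - θ) ^ 2 + (2 * Cm / ((1 - θ) * bs)) ^ 2) ≤ 3 / 4 :=
    (mul_le_mul_of_nonneg_right (pow_le_pow_left₀ he.le hee' 2) hQ0).trans hs2
  have hs4e : 64 * Cm * e ^ 3 ≤ (1 - θ) ^ 2 :=
    (mul_le_mul_of_nonneg_left (pow_le_pow_left₀ he.le hee' 3) (by positivity)).trans hs4
  obtain ⟨hu0s, hu0env, -⟩ := profStart_mem (γ := γ) hbs he h2e
  obtain ⟨hu0s', hu0env', -⟩ := profStart_mem (γ := γ) hbs he' h2e'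
  have hT := tendsto_invSq_picardIter hB hCm hθ0 hθ1 hbs hta hts htf hprof he h2e hu0s hu0env hs1e hs2e hs4e m
  have hT' := tendsto_invSq_picardIter hB hCm hθ0 hθ1 hbs hta hts htf hprof he' h2e' hu0s' hu0env' hs1 hs2 hs4 m
  have hlim := ((hT.sub hT').sub_const (1 / e ^ 2 - 1 / e' ^ 2)).abs
  exact le_of_tendsto' hlim fun n =>
    twoPin_picardIter_sep_le hB hCm hθ0 hθ1 hbs hta hts htf hprof he hee' h2e' hs1 hs2 hs5 n m

/-- **THE CONTINUUM TWO-PIN KERNEL — FOR ANY TWO BOX SOLUTIONS.**  `B` with memory profile `MemoryProfile C_m θ γ B` (0 ≤ θ < 1, C_m ≥ 0); ONE box solution t of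
`MemFlow B g* t` with the AF profile `1∕t_a² + β*·m ≤ 1∕t(m)²`; two box solutions h (pin e) and h′ (pin e′), `0 < e ≤ e′`, `2e′ ≤ γ`, e′ below the threshold
`4C_m e′ ≤ β*(1 − θ)`, `e′²·(1∕g*² + C_mγ∕(1 − θ)² + (2C_m∕((1 − θ)β*))²) ≤ 3∕4`, `64C_m e′³ ≤ (1 − θ)²`, `C_m(8e′³ + 16e′∕β*) ≤ (1 − θ)∕4`.  THEN at EVERY scale m:
**`(2∕3)(1∕e² − 1∕e′²) ≤ 1∕h(m)² − 1∕h′(m)² ≤ (4∕3)(1∕e² − 1∕e′²)`** — the solutions depend on their pins STRICTLY MONOTONICALLY and BI-LIPSCHITZ-LY in the chart 1∕g²,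
constants uniform in the scale (part 9's same-depth lattice kernel without lattice families; part 11's corollary without `eq_gstar`).
[cite: Balaban1987RG1, Thm 2 (0.31) p.259 with (0.20) p.256 and p.298] -/
theorem sep_twoSided_of_reference_flow {B : (ℕ → ℝ) → ℝ} {Cm θ γ bs ta gs e e' : ℝ} {t h h' : ℕ → ℝ}
    (hB : MemoryProfile Cm θ γ B) (hCm : 0 ≤ Cm) (hθ0 : 0 ≤ θ) (hθ1 : θ < 1) (hbs : 0 < bs) (hta : 0 < ta)
    (hts : SeqBox γ t) (htf : MemFlow B gs t) (hprof : ∀ m : ℕ, 1 / ta ^ 2 + bs * (m : ℝ) ≤ 1 / (t m) ^ 2)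
    (he : 0 < e) (hee' : e ≤ e') (h2e' : 2 * e' ≤ γ)
    (hs1 : 4 * Cm * e' ≤ bs * (1 - θ))
    (hs2 : e' ^ 2 * (1 / gs ^ 2 + Cm * γ / (1 - θ) ^ 2 + (2 * Cm / ((1 - θ) * bs)) ^ 2) ≤ 3 / 4)
    (hs4 : 64 * Cm * e' ^ 3 ≤ (1 - θ) ^ 2) (hs5 : Cm * (8 * e' ^ 3 + 16 * e' / bs) ≤ (1 - θ) / 4)
    (hhs : SeqBox γ h) (hhf : MemFlow B e h) (hhs' : SeqBox γ h') (hhf' : MemFlow B e' h') (m : ℕ) :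
    2 / 3 * (1 / e ^ 2 - 1 / e' ^ 2) ≤ 1 / (h m) ^ 2 - 1 / (h' m) ^ 2 ∧
      1 / (h m) ^ 2 - 1 / (h' m) ^ 2 ≤ 4 / 3 * (1 / e ^ 2 - 1 / e' ^ 2) := by
  have h1θ : 0 < 1 - θ := by linarith
  have he' : 0 < e' := he.trans_le hee'
  have h2e : 2 * e ≤ γ := by linarith
  have hQ0 : 0 ≤ 1 / gs ^ 2 + Cm * γ / (1 - θ) ^ 2 + (2 * Cm / ((1 - θ) * bs)) ^ 2 := by
    have hγ : 0 ≤ γ := by linarith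
    positivity
  have hs1e : 4 * Cm * e ≤ bs * (1 - θ) := (by nlinarith : 4 * Cm * e ≤ 4 * Cm * e').trans hs1
  have hs2e : e ^ 2 * (1 / gs ^ 2 + Cm * γ / (1 - θ) ^ 2 + (2 * Cm / ((1 - θ) * bs)) ^ 2) ≤ 3 / 4 :=
    (mul_le_mul_of_nonneg_right (pow_le_pow_left₀ he.le hee' 2) hQ0).trans hs2
  have hs4e : 64 * Cm * e ^ 3 ≤ (1 - θ) ^ 2 :=
    (mul_le_mul_of_nonneg_left (pow_le_pow_left₀ he.le hee' 3) (by positivity)).trans hs4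
  have heq := eq_solution_of_memFlow_of_reference hB hCm hθ0 hθ1 hbs hta hts htf hprof he h2e hs1e hs2e hs4e hhs hhf
  have heq' := eq_solution_of_memFlow_of_reference hB hCm hθ0 hθ1 hbs hta hts htf hprof he' h2e' hs1 hs2 hs4 hhs' hhf'
  have hk := sep_twoSided_solution hB hCm hθ0 hθ1 hbs hta hts htf hprof he hee' h2e' hs1 hs2 hs4 hs5 m
  rw [← heq, ← heq'] at hk
  constructor <;> linarith [(abs_le.mp hk).1, (abs_le.mp hk).2]

/-- **STRICTLY INCREASING IN THE PIN AT EVERY SCALE**: e < e′ ⟹ h(m) < h′(m) for all m. [cite: Balaban1987RG1, Thm 2 p.259 with (0.20) p.256] -/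
theorem lt_of_pin_lt {B : (ℕ → ℝ) → ℝ} {Cm θ γ bs ta gs e e' : ℝ} {t h h' : ℕ → ℝ}
    (hB : MemoryProfile Cm θ γ B) (hCm : 0 ≤ Cm) (hθ0 : 0 ≤ θ) (hθ1 : θ < 1) (hbs : 0 < bs) (hta : 0 < ta)
    (hts : SeqBox γ t) (htf : MemFlow B gs t) (hprof : ∀ m : ℕ, 1 / ta ^ 2 + bs * (m : ℝ) ≤ 1 / (t m) ^ 2)
    (he : 0 < e) (hlt : e < e') (h2e' : 2 * e' ≤ γ)
    (hs1 : 4 * Cm * e' ≤ bs * (1 - θ))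
    (hs2 : e' ^ 2 * (1 / gs ^ 2 + Cm * γ / (1 - θ) ^ 2 + (2 * Cm / ((1 - θ) * bs)) ^ 2) ≤ 3 / 4)
    (hs4 : 64 * Cm * e' ^ 3 ≤ (1 - θ) ^ 2) (hs5 : Cm * (8 * e' ^ 3 + 16 * e' / bs) ≤ (1 - θ) / 4)
    (hhs : SeqBox γ h) (hhf : MemFlow B e h) (hhs' : SeqBox γ h') (hhf' : MemFlow B e' h') (m : ℕ) : h m < h' m := by
  have hk := (sep_twoSided_of_reference_flow hB hCm hθ0 hθ1 hbs hta hts htf hprof he hlt.le h2e' hs1 hs2 hs4 hs5 hhs hhf hhs' hhf' m).1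
  have hΔ : 0 < 1 / e ^ 2 - 1 / e' ^ 2 := by
    rw [sub_pos]; exact one_div_lt_one_div_of_lt (by positivity) (pow_lt_pow_left₀ hlt he.le two_ne_zero)
  have hq := (hhs m).1
  have hq' := (hhs' m).1
  have hlt2 : 1 / (h' m) ^ 2 < 1 / (h m) ^ 2 := by linarith
  have hsq : (h m) ^ 2 < (h' m) ^ 2 := (one_div_lt_one_div (pow_pos hq' 2) (pow_pos hq 2)).mp hlt2
  exact (pow_lt_pow_iff_left₀ hq.le hq'.le two_ne_zero).mp hsq

/-- **LIPSCHITZ IN THE PIN, UNIFORMLY IN THE SCALE**: `|h(m) − h′(m)| ≤ (64∕3)·(e′ − e)` for all m (`|h − h′| ≤ h²h′|Δ| ≤ 4e²·2e′·(4∕3)(1∕e² − 1∕e′²)`, part 10's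
envelopes `h ≤ 2e`, `h′ ≤ 2e′`). [cite: Balaban1987RG1, Thm 2 p.259 with (0.20) p.256] -/
theorem abs_sub_le_of_pins {B : (ℕ → ℝ) → ℝ} {Cm θ γ bs ta gs e e' : ℝ} {t h h' : ℕ → ℝ}
    (hB : MemoryProfile Cm θ γ B) (hCm : 0 ≤ Cm) (hθ0 : 0 ≤ θ) (hθ1 : θ < 1) (hbs : 0 < bs) (hta : 0 < ta)
    (hts : SeqBox γ t) (htf : MemFlow B gs t) (hprof : ∀ m : ℕ, 1 / ta ^ 2 + bs * (m : ℝ) ≤ 1 / (t m) ^ 2)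
    (he : 0 < e) (hee' : e ≤ e') (h2e' : 2 * e' ≤ γ)
    (hs1 : 4 * Cm * e' ≤ bs * (1 - θ))
    (hs2 : e' ^ 2 * (1 / gs ^ 2 + Cm * γ / (1 - θ) ^ 2 + (2 * Cm / ((1 - θ) * bs)) ^ 2) ≤ 3 / 4)
    (hs4 : 64 * Cm * e' ^ 3 ≤ (1 - θ) ^ 2) (hs5 : Cm * (8 * e' ^ 3 + 16 * e' / bs) ≤ (1 - θ) / 4)
    (hhs : SeqBox γ h) (hhf : MemFlow B e h) (hhs' : SeqBox γ h') (hhf' : MemFlow B e' h') (m : ℕ) :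
    |h m - h' m| ≤ 64 / 3 * (e' - e) := by
  have h1θ : 0 < 1 - θ := by linarith
  have he' : 0 < e' := he.trans_le hee'
  have hQ0 : 0 ≤ 1 / gs ^ 2 + Cm * γ / (1 - θ) ^ 2 + (2 * Cm / ((1 - θ) * bs)) ^ 2 := by
    have hγ : 0 ≤ γ := by linarith
    positivity
  have hs1e : 4 * Cm * e ≤ bs * (1 - θ) := (by nlinarith : 4 * Cm * e ≤ 4 * Cm * e').trans hs1
  have hs2e : e ^ 2 * (1 / gs ^ 2 + Cm * γ / (1 - θ) ^ 2 + (2 * Cm / ((1 - θ) * bs)) ^ 2) ≤ 3 / 4 :=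
    (mul_le_mul_of_nonneg_right (pow_le_pow_left₀ he.le hee' 2) hQ0).trans hs2
  have hk := sep_twoSided_of_reference_flow hB hCm hθ0 hθ1 hbs hta hts htf hprof he hee' h2e' hs1 hs2 hs4 hs5 hhs hhf hhs' hhf' m
  have hΔ0 : 0 ≤ 1 / e ^ 2 - 1 / e' ^ 2 := by
    rw [sub_nonneg]; exact one_div_le_one_div_of_le (by positivity) (pow_le_pow_left₀ he.le hee' 2)
  have habs : |1 / (h m) ^ 2 - 1 / (h' m) ^ 2| ≤ 4 / 3 * (1 / e ^ 2 - 1 / e' ^ 2) := by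
    rw [abs_le]; constructor <;> linarith [hk.1, hk.2]
  have hq := (hhs m).1
  have hq' := (hhs' m).1
  have henv : h m ≤ 2 * e := le_two_mul_pin_of_reference_flow hB hCm hθ0 hθ1 hbs hta hts htf hprof hhs hhf hs1e hs2e m
  have henv' : h' m ≤ 2 * e' := le_two_mul_pin_of_reference_flow hB hCm hθ0 hθ1 hbs hta hts htf hprof hhs' hhf' hs1 hs2 m
  have hw : (h m) ^ 2 * h' m ≤ (2 * e) ^ 2 * (2 * e') :=
    mul_le_mul (pow_le_pow_left₀ hq.le henv 2) henv' hq'.le (by positivity)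
  have hid : (2 * e) ^ 2 * (2 * e') * (4 / 3 * (1 / e ^ 2 - 1 / e' ^ 2)) = 32 / 3 * ((e' - e) * (e' + e) / e') := by
    field_simp
    ring
  have hfrac : (e' - e) * (e' + e) / e' ≤ 2 * (e' - e) := by
    rw [div_le_iff₀ he']; nlinarith
  calc |h m - h' m| ≤ (h m) ^ 2 * h' m * |1 / (h m) ^ 2 - 1 / (h' m) ^ 2| := abs_sub_le_of_inv_sq hq hq'
    _ ≤ (2 * e) ^ 2 * (2 * e') * (4 / 3 * (1 / e ^ 2 - 1 / e' ^ 2)) := mul_le_mul hw habs (abs_nonneg _) (by positivity)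
    _ = 32 / 3 * ((e' - e) * (e' + e) / e') := hid
    _ ≤ 32 / 3 * (2 * (e' - e)) := mul_le_mul_of_nonneg_left hfrac (by norm_num)
    _ = 64 / 3 * (e' - e) := by ring

end

end Summit.QuantumFields.BalabanUV.Beta.EriceFlowEnclosureB12AsPrintedHistoryContagionShiftFlowPicardPin
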